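import Summits.Ventures.QEC.Thresholds.ToricCodeThresholdKernelSymmK16
import Summits.Ventures.QEC.Thresholds.ToricCodePhenomenologicalKernelZ3SymmK12
import Summits.Ventures.QEC.Thresholds.ToricCodeInhomogeneousThresholds
import Summits.Ventures.QEC.Thresholds.PhenomenologicalBoxThresholds
import HarnessLib

/-!
# MWPM, inhomogeneous, two-rate and box rows at the memory-16 / cubic memory-12 kernel decimals:
# `p_c^{MWPM} > .0357` (both sectors), `> .0535` (depolarizing), `> .0112` (`T` noisy rounds); rates `≤ .0357`;
# `p, q ≤ .0112` — UNCONDITIONAL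

Venture QEC, `Summits/Ventures/QEC/Thresholds/` (LADDER-QEC Q5 «toric/surface + MWPM»; qec-type-09 gen 5; continues
`ToricCodeMWPMThresholdsSymm.lean` (`.0355 / .0532 / .0111`, memory-14 / cubic memory-10 certificates),
`ToricCodeInhomogeneousThresholds.lean` (rates `≤ .0355`), `ToricCodePhenomenologicalAnisotropicThresholds.lean` and
`PhenomenologicalBoxThresholds.lean` (`p, q ≤ .0111`)). qec-type-03's SYMMETRY-REDUCED kernel certificates
`SAW.Zd.connectiveConstant_two_le_26939` (`μ(ℤ²) ≤ 2.6939`, Pönitz–Tittmann Table 2, `d = 2, k = 16`) and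
`SAW.Zd.FiniteMemory3.connectiveConstant_three_le_47476` (`μ(ℤ³) ≤ 4.7476`, `d = 3, k = 12`) moved the minimum-weight decimals
to `.0357 / .0535 / .0112` (`ToricCodeThresholdKernelSymmK16.lean`, `ToricCodePhenomenologicalKernelZ3SymmK12.lean`). This file
moves the DECODER-CLASS and TWO-RATE corollaries with them: by `IsMatchingDecoder.isMinWeight` (Edmonds–Johnson /
Korte–Vygen Thm 12.9, `MatchingDecoders.lean`) through the bridges `ToricCode.isMinWeight_of_isMatchingDecoder_star / _plaq / _st`
every decimal holds for EVERY minimum-weight-perfect-matching decoder family (any admissible link metric, tie-break,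
geodesics); the inhomogeneous (link-dependent rates `≤ ρ`) and anisotropic (`p ≠ q`) rows follow from the symbolic theorems
`toric_inhom_belowThreshold_of_connectiveConstant_le` / `phenom_aniso_belowThreshold_of_connectiveConstant_le`.
All UNCONDITIONAL, tier CERTIFIED (kernel), axioms standard, 0 facts; certified LOWER bounds on the threshold (region);
no new constant. NOT A THEOREM ANYWHERE: DKLP's printed `.0373` / `.0114` (CLAIMS).

| theorem | statement |
|---|---|
| `toric_mwpm_threshold_kernelSymmK16`, `toric_mwpm_accuracyThreshold_gt_0357`, `toric_mwpm_hasThreshold_0357`, `toric_mwpm_decaysExponentially_0357`, `exists_mwpm_family_accuracyThreshold_gt_0357` | `Z`-sector, perfect measurement, every MWPM family: `≥ p₀(2.6939)`, **`p_c > .0357`**, decay below, non-vacuity |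
| `toric_x_mwpm_accuracyThreshold_gt_0357` | `X`-sector (plaquette matching): `p_c > .0357` |
| `toric_depolarizing_mwpm_threshold_kernelSymmK16`, `toric_depolarizing_mwpm_accuracyThreshold_gt_0535` | depolarizing, sector-wise MWPM: `≥ (3/2)·p₀(2.6939)`, **`p_c > .0535`** |
| `phenom_mwpm_threshold_kernelZ3SymmK12`, `phenom_mwpm_accuracyThreshold_gt_0112`, `phenom_mwpm_decaysExponentially_0112`, `exists_st_mwpm_family_accuracyThreshold_gt_0112` | `T(L)` noisy rounds (`q = p`, poly `T`), space-time MWPM: **`p_c > .0112`** |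
| `toric_inhom_belowThreshold_kernelSymmK16`, `toric_inhom_belowThreshold_0357`, `toric_inhom_mwpm_belowThreshold_0357` | link-dependent rates `0 ≤ p_{L,ℓ} ≤ ρ < p₀(2.6939)`, resp. `≤ .0357` ⇒ `Prob_fail → 0` (min-weight, resp. MWPM) |
| `phenom_aniso_belowThreshold_kernelZ3SymmK12`, `phenom_aniso_belowThreshold_0112`, `phenom_aniso_mwpm_belowThreshold_0112` | two rates: `max(p,q) < p₀(4.7476)`, resp. `p, q ≤ .0112` ⇒ `Prob_fail(p,q) → 0` |
| `phenom_isThresholdBoxLowerBound_kernelZ3SymmK12`, `phenom_isThresholdBoxLowerBound_0112`, `phenom_mwpm_isThresholdBoxLowerBound_0112` | the same as `IsThresholdBoxLowerBound` boxes `p₀(4.7476)` / **`.0112`** |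

## References
* [DennisEtAl2002] E. Dennis, A. Kitaev, A. Landahl, J. Preskill, *Topological quantum memory*, J. Math. Phys. 43
  (2002) 4452–4505, arXiv:quant-ph/0110143, §4.2 (rates p, q), §4.4 p. 18, §5.1 p. 19, §5.3 eqs. (threshold_2d),
  (p_c_2d), (fail_2d), (threshold_iso), (threshold_iso_num), (fail_iso).
* [PonitzTittmann2000] A. Pönitz, P. Tittmann, Electron. J. Combin. 7 (2000) R21, Table 2 (`d = 2, k = 16`: `2.6939`;
  `d = 3, k = 12`: `4.7476`).
-/

namespace Summit.Ventures.QEC.Thresholds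

open Filter Topology Finset
open Literature.InformationTheory.QuantumCodes
open Literature.InformationTheory.QuantumCodes.ToricCode
open Literature.Probability.RandomPlanarGeometry

/-! ### Perfect measurement, `Z`-sector: every MWPM family has `p_c > .0357` -/

/-- **Toric threshold `≥ p₀(2.6939)` for every MWPM decoder family** — UNCONDITIONAL, kernel (symmetry-reduced
memory-16 certificate). [cite: DennisEtAl2002, §4.4 p. 18 and §5.3 eq. (threshold_2d)] -/
theorem toric_mwpm_threshold_kernelSymmK16 (m : (L : ℕ) → EdgeMetric (starEnds (L + 1)))
    {D : (L : ℕ) → ZDecoder (L + 1)} (hD : ∀ L, IsMatchingDecoder (m L) (D L)) :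
    IsThresholdLowerBound (toricFailureFamily D) (thresholdValue 2.6939) :=
  toricThreshold_kernelSymmK16 fun L => isMinWeight_of_isMatchingDecoder_star (hD L)

/-- **`p_c^{MWPM} > .0357`** (perfect measurement, `Z`-sector) for every MWPM decoder family — UNCONDITIONAL, kernel
(was `.0355`). [cite: DennisEtAl2002, §4.4 p. 18 and §5.3 eq. (p_c_2d)] -/
theorem toric_mwpm_accuracyThreshold_gt_0357 (m : (L : ℕ) → EdgeMetric (starEnds (L + 1)))
    {D : (L : ℕ) → ZDecoder (L + 1)} (hD : ∀ L, IsMatchingDecoder (m L) (D L)) :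
    (0.0357 : ℝ) < accuracyThreshold (toricFailureFamily D) :=
  accuracyThreshold_gt_0357 fun L => isMinWeight_of_isMatchingDecoder_star (hD L)

/-- `HasThreshold` (row-09 PMF vocabulary) at `.0357` for every MWPM family — UNCONDITIONAL, kernel.
[cite: DennisEtAl2002, §4.4 p. 18 and §5.3 eq. (p_c_2d)] -/
theorem toric_mwpm_hasThreshold_0357 (m : (L : ℕ) → EdgeMetric (starEnds (L + 1)))
    {D : (L : ℕ) → ZDecoder (L + 1)} (hD : ∀ L, IsMatchingDecoder (m L) (D L)) :
    HasThreshold (fun L p => (D L).logicalFailureProb (syn (L + 1)) (boundaries (L + 1))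
      (iidLaw (bitLaw (min p.toNNReal 1) (min_le_right _ _)))) 0.0357 :=
  hasThreshold_toric_0357 fun L => isMinWeight_of_isMatchingDecoder_star (hD L)

/-- **Exponential decay of the MWPM failure probability at every `0 ≤ p ≤ .0357`** — UNCONDITIONAL, kernel.
[cite: DennisEtAl2002, §5.3 eq. (fail_2d)] -/
theorem toric_mwpm_decaysExponentially_0357 (m : (L : ℕ) → EdgeMetric (starEnds (L + 1)))
    {D : (L : ℕ) → ZDecoder (L + 1)} (hD : ∀ L, IsMatchingDecoder (m L) (D L)) {p : ℝ} (hp₀ : 0 ≤ p)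
    (hpp : p ≤ 0.0357) : DecaysExponentially (toricFailureFamily D) p :=
  toric_decaysExponentially_0357 (fun L => isMinWeight_of_isMatchingDecoder_star (hD L)) hp₀ hpp

/-- **Non-vacuity**: there IS an MWPM family (lattice distance `starMetric`, some tie-break, some geodesics), and its
certified threshold exceeds `.0357`. [cite: DennisEtAl2002, §4.4 p. 18] -/
theorem exists_mwpm_family_accuracyThreshold_gt_0357 :
    ∃ D : (L : ℕ) → ZDecoder (L + 1), (∀ L, IsMatchingDecoder (starMetric (L + 1)) (D L)) ∧
      (0.0357 : ℝ) < accuracyThreshold (toricFailureFamily D) := by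
  choose D hD using fun L => exists_isMatchingDecoder_star (L + 1)
  exact ⟨D, hD, toric_mwpm_accuracyThreshold_gt_0357 (fun L => starMetric (L + 1)) hD⟩

/-! ### Perfect measurement, `X`-sector and depolarizing noise -/

/-- **`p_c^X > .0357` for every MWPM decoder family of the plaquette syndrome** (bit flips) — UNCONDITIONAL, kernel
(was `.0355`). [cite: DennisEtAl2002, §4.4 p. 18 and §5.3 eq. (p_c_2d)] -/
theorem toric_x_mwpm_accuracyThreshold_gt_0357 (m : (L : ℕ) → EdgeMetric (plaqEnds (L + 1)))
    (DX : (L : ℕ) → Decoder (Syndrome (L + 1)) (Chain (L + 1))) (hDX : ∀ L, IsMatchingDecoder (m L) (DX L)) :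
    (0.0357 : ℝ) < accuracyThreshold (xFailureFamily (fun L => toricCode (L + 1)) DX) :=
  toric_x_accuracyThreshold_gt_0357 DX fun L => isMinWeight_of_isMatchingDecoder_plaq (hDX L)

/-- **Depolarizing threshold `≥ (3/2)·p₀(2.6939)` for sector-wise MWPM decoding of the toric code** (any pair of MWPM
families for the two syndromes) — UNCONDITIONAL, kernel. [cite: DennisEtAl2002, §4.1 and §5.3 eq. (threshold_2d)] -/
theorem toric_depolarizing_mwpm_threshold_kernelSymmK16 (mX : (L : ℕ) → EdgeMetric (plaqEnds (L + 1)))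
    (mZ : (L : ℕ) → EdgeMetric (starEnds (L + 1)))
    (DX : (L : ℕ) → Decoder (Syndrome (L + 1)) (Chain (L + 1))) (DZ : (L : ℕ) → ZDecoder (L + 1))
    (hDX : ∀ L, IsMatchingDecoder (mX L) (DX L)) (hDZ : ∀ L, IsMatchingDecoder (mZ L) (DZ L)) :
    IsThresholdLowerBound (depolarizingFailureFamily (fun L => toricCode (L + 1)) DX DZ)
      (3 / 2 * thresholdValue 2.6939) :=
  toric_depolarizing_isThresholdLowerBound_kernelSymmK16 DX DZ
    (fun L => isMinWeight_of_isMatchingDecoder_plaq (hDX L)) fun L => isMinWeight_of_isMatchingDecoder_star (hDZ L)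

/-- **`p_c^depol > .0535` for sector-wise MWPM decoding of the toric code** — UNCONDITIONAL, kernel (was `.0532`).
[cite: DennisEtAl2002, §4.1 and §5.3 eq. (p_c_2d)] -/
theorem toric_depolarizing_mwpm_accuracyThreshold_gt_0535 (mX : (L : ℕ) → EdgeMetric (plaqEnds (L + 1)))
    (mZ : (L : ℕ) → EdgeMetric (starEnds (L + 1)))
    (DX : (L : ℕ) → Decoder (Syndrome (L + 1)) (Chain (L + 1))) (DZ : (L : ℕ) → ZDecoder (L + 1))
    (hDX : ∀ L, IsMatchingDecoder (mX L) (DX L)) (hDZ : ∀ L, IsMatchingDecoder (mZ L) (DZ L)) :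
    (0.0535 : ℝ) < accuracyThreshold (depolarizingFailureFamily (fun L => toricCode (L + 1)) DX DZ) :=
  toric_depolarizing_accuracyThreshold_gt_0535 DX DZ
    (fun L => isMinWeight_of_isMatchingDecoder_plaq (hDX L)) fun L => isMinWeight_of_isMatchingDecoder_star (hDZ L)

/-! ### `T` noisy rounds (`q = p`): every space-time MWPM family has `p_c > .0112` -/

/-- **Phenomenological threshold `≥ p₀(4.7476)` for every space-time MWPM decoder family** (`q = p`, poly-bounded `T`) —
UNCONDITIONAL, kernel (symmetry-reduced cubic memory-12 certificate).
[cite: DennisEtAl2002, §5.1 p. 19 and §5.3 eq. (threshold_iso_num)] -/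
theorem phenom_mwpm_threshold_kernelZ3SymmK12 {T : ℕ → ℕ} (hT : IsPolyBounded T)
    (m : (L : ℕ) → EdgeMetric (stLinkEnds (L + 1) (T L))) {D : (L : ℕ) → STDecoder (L + 1) (T L)}
    (hD : ∀ L, IsMatchingDecoder (m L) (D L)) :
    IsThresholdLowerBound (phenomFailureFamily T D) (thresholdValue 4.7476) :=
  phenomThreshold_kernelZ3SymmK12 hT fun L => isMinWeight_of_isMatchingDecoder_st (hD L)

/-- **`p_c^{MWPM} > .0112` under phenomenological noise** for every space-time MWPM family — UNCONDITIONAL, kernel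
(was `.0111`; equals the former Pönitz–Tittmann-CONDITIONAL decimal, now hypothesis-free).
[cite: DennisEtAl2002, §5.1 p. 19 and §5.3 eq. (threshold_iso_num)] -/
theorem phenom_mwpm_accuracyThreshold_gt_0112 {T : ℕ → ℕ} (hT : IsPolyBounded T)
    (m : (L : ℕ) → EdgeMetric (stLinkEnds (L + 1) (T L))) {D : (L : ℕ) → STDecoder (L + 1) (T L)}
    (hD : ∀ L, IsMatchingDecoder (m L) (D L)) :
    (0.0112 : ℝ) < accuracyThreshold (phenomFailureFamily T D) :=
  phenom_accuracyThreshold_gt_0112 hT fun L => isMinWeight_of_isMatchingDecoder_st (hD L)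

/-- **Exponential decay at every `0 ≤ p ≤ .0112`** for space-time MWPM families — UNCONDITIONAL, kernel.
[cite: DennisEtAl2002, §5.3 eq. (fail_iso)] -/
theorem phenom_mwpm_decaysExponentially_0112 {T : ℕ → ℕ} (hT : IsPolyBounded T)
    (m : (L : ℕ) → EdgeMetric (stLinkEnds (L + 1) (T L))) {D : (L : ℕ) → STDecoder (L + 1) (T L)}
    (hD : ∀ L, IsMatchingDecoder (m L) (D L)) {p : ℝ} (hp₀ : 0 ≤ p) (hpp : p ≤ 0.0112) :
    DecaysExponentially (phenomFailureFamily T D) p :=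
  phenom_decaysExponentially_0112 hT (fun L => isMinWeight_of_isMatchingDecoder_st (hD L)) hp₀ hpp

/-- **Non-vacuity** (schedule `T(L) = L + 1`, lattice metric of the space-time complex): a space-time MWPM family
exists and its certified phenomenological threshold exceeds `.0112`. [cite: DennisEtAl2002, §5.1 p. 19] -/
theorem exists_st_mwpm_family_accuracyThreshold_gt_0112 :
    ∃ D : (L : ℕ) → STDecoder (L + 1) (L + 1), (∀ L, IsMatchingDecoder (stMetric (L + 1) (L + 1)) (D L)) ∧
      (0.0112 : ℝ) < accuracyThreshold (phenomFailureFamily (fun L => L + 1) D) := by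
  choose D hD using fun L => exists_isMatchingDecoder_st (L + 1) (L + 1)
  exact ⟨D, hD, phenom_mwpm_accuracyThreshold_gt_0112 isPolyBounded_succ (fun L => stMetric (L + 1) (L + 1)) hD⟩

/-! ### Inhomogeneous independent noise: link-dependent rates `≤ .0357` -/

/-- **Inhomogeneous-noise toric threshold from the kernel bound `μ(ℤ²) ≤ 2.6939`**: rates `0 ≤ p_{L,ℓ} ≤ ρ < p₀(2.6939)`
suffice, for every minimum-weight decoder family — UNCONDITIONAL, tier CERTIFIED (kernel).
[cite: DennisEtAl2002, §5.3 eq. (threshold_2d)] -/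
theorem toric_inhom_belowThreshold_kernelSymmK16 {D : (L : ℕ) → ZDecoder (L + 1)}
    (hD : ∀ L, (D L).IsMinWeight (syn (L + 1)) (cycles (L + 1)) hammingNorm)
    {r : (L : ℕ) → Edge (L + 1) → ℝ} {ρ : ℝ} (hr0 : ∀ L ℓ, 0 ≤ r L ℓ) (hrρ : ∀ L ℓ, r L ℓ ≤ ρ)
    (hρt : ρ < thresholdValue 2.6939) :
    Tendsto (fun L => failureProbInhom (L + 1) (D L) (r L)) atTop (𝓝 0) :=
  toric_inhom_belowThreshold_of_connectiveConstant_le (by norm_num) SAW.Zd.connectiveConstant_two_le_26939 hD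
    hr0 hrρ hρt

/-- **Decimal form: link-dependent rates `0 ≤ p_{L,ℓ} ≤ .0357` ⇒ `Prob_fail → 0`** for every minimum-weight decoder
family — UNCONDITIONAL, kernel (was `.0355`; a certified LOWER bound on the inhomogeneous threshold region).
[cite: DennisEtAl2002, §5.3 eq. (p_c_2d)] -/
theorem toric_inhom_belowThreshold_0357 {D : (L : ℕ) → ZDecoder (L + 1)}
    (hD : ∀ L, (D L).IsMinWeight (syn (L + 1)) (cycles (L + 1)) hammingNorm)
    {r : (L : ℕ) → Edge (L + 1) → ℝ} (hr0 : ∀ L ℓ, 0 ≤ r L ℓ) (hr : ∀ L ℓ, r L ℓ ≤ 0.0357) :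
    Tendsto (fun L => failureProbInhom (L + 1) (D L) (r L)) atTop (𝓝 0) :=
  toric_inhom_belowThreshold_kernelSymmK16 hD hr0 hr thresholdValue_26939_bounds.1

/-- **The same for every MWPM decoder family**: rates `≤ .0357` ⇒ `Prob_fail → 0` — UNCONDITIONAL, kernel.
[cite: DennisEtAl2002, §4.4 p. 18 and §5.3 eq. (p_c_2d)] -/
theorem toric_inhom_mwpm_belowThreshold_0357 (m : (L : ℕ) → EdgeMetric (starEnds (L + 1)))
    {D : (L : ℕ) → ZDecoder (L + 1)} (hD : ∀ L, IsMatchingDecoder (m L) (D L))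
    {r : (L : ℕ) → Edge (L + 1) → ℝ} (hr0 : ∀ L ℓ, 0 ≤ r L ℓ) (hr : ∀ L ℓ, r L ℓ ≤ 0.0357) :
    Tendsto (fun L => failureProbInhom (L + 1) (D L) (r L)) atTop (𝓝 0) :=
  toric_inhom_belowThreshold_0357 (fun L => isMinWeight_of_isMatchingDecoder_star (hD L)) hr0 hr

/-! ### Two rates `p ≠ q` (anisotropic phenomenological noise): `p, q ≤ .0112` -/

/-- **Two-rate phenomenological threshold from the kernel bound `μ(ℤ³) ≤ 4.7476`**: `max(p, q) < p₀(4.7476)` suffices,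
for every poly-bounded schedule and every minimum-weight space-time decoder family — UNCONDITIONAL, tier CERTIFIED
(kernel). [cite: DennisEtAl2002, §5.3 eqs. (threshold_iso), (threshold_iso_num)] -/
theorem phenom_aniso_belowThreshold_kernelZ3SymmK12 {T : ℕ → ℕ} (hT : IsPolyBounded T)
    {D : (L : ℕ) → STDecoder (L + 1) (T L)}
    (hD : ∀ L, (D L).IsMinWeight (stSyn (L + 1) (T L)) (stCycles (L + 1) (T L)) hammingNorm)
    {p q : ℝ} (hp0 : 0 ≤ p) (hq0 : 0 ≤ q) (hpq : max p q < thresholdValue 4.7476) :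
    Tendsto (fun L => phenomFailureProb (L + 1) (T L) (D L) p q) atTop (𝓝 0) :=
  phenom_aniso_belowThreshold_of_connectiveConstant_le (by norm_num)
    SAW.Zd.FiniteMemory3.connectiveConstant_three_le_47476 hT hD hp0 hq0 hpq

/-- **Decimal form: `0 ≤ p ≤ .0112` and `0 ≤ q ≤ .0112` ⇒ `Prob_fail(p, q) → 0`** for every poly-bounded schedule and
every minimum-weight space-time decoder family — UNCONDITIONAL, kernel (was `.0111`; printed `p, q < .0114` remains a
CLAIM). [cite: DennisEtAl2002, §5.3 eq. (threshold_iso_num)] -/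
theorem phenom_aniso_belowThreshold_0112 {T : ℕ → ℕ} (hT : IsPolyBounded T)
    {D : (L : ℕ) → STDecoder (L + 1) (T L)}
    (hD : ∀ L, (D L).IsMinWeight (stSyn (L + 1) (T L)) (stCycles (L + 1) (T L)) hammingNorm)
    {p q : ℝ} (hp0 : 0 ≤ p) (hq0 : 0 ≤ q) (hp : p ≤ 0.0112) (hq : q ≤ 0.0112) :
    Tendsto (fun L => phenomFailureProb (L + 1) (T L) (D L) p q) atTop (𝓝 0) :=
  phenom_aniso_belowThreshold_kernelZ3SymmK12 hT hD hp0 hq0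
    (lt_of_le_of_lt (max_le hp hq) thresholdValue_47476_bounds.1)

/-- **The same for every space-time MWPM decoder family**: `p, q ≤ .0112 ⇒ Prob_fail(p,q) → 0` — UNCONDITIONAL,
kernel. [cite: DennisEtAl2002, §5.1 p. 19 and §5.3 eq. (threshold_iso_num)] -/
theorem phenom_aniso_mwpm_belowThreshold_0112 {T : ℕ → ℕ} (hT : IsPolyBounded T)
    (m : (L : ℕ) → EdgeMetric (stLinkEnds (L + 1) (T L))) {D : (L : ℕ) → STDecoder (L + 1) (T L)}
    (hD : ∀ L, IsMatchingDecoder (m L) (D L)) {p q : ℝ} (hp0 : 0 ≤ p) (hq0 : 0 ≤ q) (hp : p ≤ 0.0112)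
    (hq : q ≤ 0.0112) : Tendsto (fun L => phenomFailureProb (L + 1) (T L) (D L) p q) atTop (𝓝 0) :=
  phenom_aniso_belowThreshold_0112 hT (fun L => isMinWeight_of_isMatchingDecoder_st (hD L)) hp0 hq0 hp hq

/-! ### The same region as `IsThresholdBoxLowerBound` boxes -/

/-- **Threshold box `p₀(4.7476)`** (kernel bound `μ(ℤ³) ≤ 4.7476`), every poly-bounded schedule and every minimum-weight
space-time decoder family — UNCONDITIONAL, kernel. [cite: DennisEtAl2002, §5.3 eqs. (threshold_iso), (threshold_iso_num)] -/
theorem phenom_isThresholdBoxLowerBound_kernelZ3SymmK12 {T : ℕ → ℕ} (hT : IsPolyBounded T)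
    {D : (L : ℕ) → STDecoder (L + 1) (T L)}
    (hD : ∀ L, (D L).IsMinWeight (stSyn (L + 1) (T L)) (stCycles (L + 1) (T L)) hammingNorm) :
    IsThresholdBoxLowerBound (phenomFailureFamily₂ T D) (thresholdValue 4.7476) :=
  phenom_isThresholdBoxLowerBound_of_connectiveConstant_le (by norm_num)
    SAW.Zd.FiniteMemory3.connectiveConstant_three_le_47476 hT hD

/-- **The decimal box `.0112`**: every `0 ≤ p, q < .0112` is below threshold, for every poly-bounded schedule and every
minimum-weight space-time decoder family — UNCONDITIONAL, kernel (was `.0111`).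
[cite: DennisEtAl2002, §5.3 eq. (threshold_iso_num)] -/
theorem phenom_isThresholdBoxLowerBound_0112 {T : ℕ → ℕ} (hT : IsPolyBounded T)
    {D : (L : ℕ) → STDecoder (L + 1) (T L)}
    (hD : ∀ L, (D L).IsMinWeight (stSyn (L + 1) (T L)) (stCycles (L + 1) (T L)) hammingNorm) :
    IsThresholdBoxLowerBound (phenomFailureFamily₂ T D) 0.0112 :=
  (phenom_isThresholdBoxLowerBound_kernelZ3SymmK12 hT hD).mono thresholdValue_47476_bounds.1.le

/-- **The decimal box `.0112` for every space-time MWPM decoder family** — UNCONDITIONAL, kernel.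
[cite: DennisEtAl2002, §5.1 p. 19 and §5.3 eq. (threshold_iso_num)] -/
theorem phenom_mwpm_isThresholdBoxLowerBound_0112 {T : ℕ → ℕ} (hT : IsPolyBounded T)
    (m : (L : ℕ) → EdgeMetric (stLinkEnds (L + 1) (T L))) {D : (L : ℕ) → STDecoder (L + 1) (T L)}
    (hD : ∀ L, IsMatchingDecoder (m L) (D L)) :
    IsThresholdBoxLowerBound (phenomFailureFamily₂ T D) 0.0112 :=
  phenom_isThresholdBoxLowerBound_0112 hT fun L => isMinWeight_of_isMatchingDecoder_st (hD L)

end Summit.Ventures.QEC.Thresholds
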